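import Summits.BirchSwinnertonDyer.BirchSwinnertonDyer.Theorems.SchneiderFreeAdditiveX3SemistableTwistLocalThree
import Summits.BirchSwinnertonDyer.Rank1Residual.X2.TateLineDecomposition
import HarnessLib

/-!
# Route `SchneiderFreeAdditiveX3` (K1 door): the NON-ANOMALOUS CLAUSE at the additive prime of a
# POTENTIALLY MULTIPLICATIVE curve FROM THE TWIST — `W = V ⊗ χ_{p*}`, `V` NON-SPLIT multiplicative;
# every odd `p`, NEW AT `p = 3` (the (M) cell: 1 127 of its 4 383 pairs at `p = 3`)

Cell `bsd-schneider-ideate`, seat `bsd-schneider-door-c5` (prover, generation 25; assembly layer; `--supports` 19177).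
PARTITION: board row B6 ∩ X3 ∩ sst-twist, `r = 1` (7 101 pairs; (M) half 4 541, of which 4 383 at `p = 3`) of
`Rank1Residual.partition`; types-the-object-of nothing new; supplies the LOCAL input `hna` of generations 23–24's road on the
(M) cell at `p = 3` for the pairs whose `p*`-twist is NON-SPLIT multiplicative (census kit j319291: 1 127 of 4 383; FYI crux r2
`PotMultBranchIMC` 19176); closes none of B6's cells (BSD NOT advanced). bears_on: K1-door (items 18971/18972 → 19177 r3, 19176 r2).

WHAT.  The companion `…SemistableTwistLocalThree` treats `W = C • V^{(p*)}` with `V` good ordinary (`K` = kernel of reduction,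
`φ` = Frobenius acting by `a_p(V)`).  Here `V` is MULTIPLICATIVE at `p`: `K` := the Tate line `C[p] ≤ V[p]` at the prime
`𝔓₀ = adicCompletionPrime ℚ v` (tree `X2.IsogenyLineType.exists_line_adicCompletionPrime_of_datum` on the datum of
`X2.GreenbergVatsalTateDatumCofree.exists_data_of_not_split`; PROVED twisted Tate uniformisation `…corV54…_holds`): inertia
acts trivially on `V[p]/K` and moves `K`.  For `V` NON-SPLIT the tree's `X2.TateLineDecomposition.not_fix_and_not_quot_of_not_split`
(applied to `Φ := K` itself) gives `g ∈ D_{𝔓₀}` acting NON-trivially on the line `V[p]/K`, i.e. by a scalar `a ≢ 1 (mod p)`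
(`V[p] = ℤQ ⊕ K`); `K` is `D_{𝔓₀}`-stable (`K = ℤ·(σ₀Q₀ − Q₀)` for an inertia element `σ₀`, and `I ⊴ D`); correcting `g` by
inertia gives `φ` with `χ̄_p(φ) = 1`, hence `φ√p* = √p*` (companion §1), still acting by `a` modulo `K`.  The abstract lemma
`not_fix_and_not_quot_of_kernelLine` then yields, at every odd `p`: for every `𝔓 ∣ p` and every rational line `Φ ≤ W[p]`, `D_𝔓`
neither fixes `Φ` pointwise nor acts trivially on `W[p]/Φ`.  (At `p ≥ 5` generation 23's `not_fix_and_not_quot_of_mult_pStar_twist`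
needs no hypothesis on `V`; at `p = 3`, `W[3]|_{D} ~ (δ ∗; 0 ωδ)` with `δ` the unramified quadratic character of `V`, and the clause
holds iff `δ ≠ 1`, i.e. iff `V` is NON-SPLIT — for split `V` the line `δ` is fixed pointwise.)

* §1 `not_fix_and_not_quot_of_nonsplitMult_pStar_twist` (every `𝔓 ∣ p`, every rational line), `…_of_card_eq` (every subgroup of
  order `p`, given `Red W p`); §2 the (M) cell: `not_fix_and_not_quot_of_classX3_of_subM_of_forall_twist` under the per-pair clause
  «every multiplicative `p*`-twist model of `W` is non-split» (one census-checkable bit per pair).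

HONEST FRAMING: theorems only (finite group theory on the `𝔽_p`-plane over tree theorems, the Tate uniformisation facts being the
tree's PROVED `_holds` theorems); no definition, no named fact, no `sorry`; nothing for the pairs with SPLIT twist (3 256 of 4 383 at
`p = 3`); nothing about BSD or a main conjecture is asserted; «closes rung: none».  References: Silverman *ATAEC* V.5.3–5.4
[SilvermanATAEC1994], *AEC* X.5.4 [SilvermanAEC2009]; Serre 1972 §1.12 [Serre1972]; Greenberg–Vatsal 2000 §2 [GreenbergVatsal2000].
-/

set_option autoImplicit false
set_option linter.dupNamespace false -- the summit namespace `…BirchSwinnertonDyer.BirchSwinnertonDyer.Theorems` (Sub = Summit, D-0017) trips it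

noncomputable section

open scoped Classical NumberField Pointwise

open WeierstrassCurve NumberField IsDedekindDomain Field
  Literature.NumberTheory.EllipticCurves Literature.NumberTheory.GaloisRepresentations
  Literature.NumberTheory.EllipticCurves.GreenbergSelmer
  Literature.NumberTheory.EllipticCurves.Rank1Residual
  Summit.BirchSwinnertonDyer.Rank1Residual Summit.BirchSwinnertonDyer.Rank1Residual.GaloisImage
  Summit.BirchSwinnertonDyer.Rank1Residual.Additive Summit.BirchSwinnertonDyer.Rank1Residual.AdditivePotMult
  Summit.BirchSwinnertonDyer.Rank1Residual.X2
  Summit.BirchSwinnertonDyer.BirchSwinnertonDyer.Theorems.SchneiderFreeAdditiveX3.SemistableTwistLocal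

namespace Summit.BirchSwinnertonDyer.BirchSwinnertonDyer.Theorems.SchneiderFreeAdditiveX3.SemistableTwistLocalThree

/-! ### §1 The Tate line of a non-split multiplicative curve feeds the abstract local lemma -/

section Mult

variable {V W : WeierstrassCurve ℚ} [V.IsElliptic] [V.IsGloballyMinimal] (p : ℕ) [hp : Fact p.Prime]

/-- **(M) shape from a NON-SPLIT twist, every prime above `p`, every odd `p`.**  `V/ℚ` globally minimal with NON-SPLIT
multiplicative reduction at `p`, `W = C • V^{(p*)}`: for every `𝔓 ∣ p` and every rational line `Φ ≤ W[p]`, `D_𝔓` neither fixes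
`Φ` pointwise nor acts trivially on `W[p]/Φ`.  (Tate line `K` at `adicCompletionPrime ℚ v`; `X2.TateLineDecomposition` for
`Φ := K` gives `g ∈ D` acting on `V[p]/K` by `a ≢ 1`; `φ = g·τ₀` with `χ̄_p(φ) = 1`; the abstract lemma; conjugation to every `𝔓`.)
New at `p = 3`; at `p ≥ 5` generation 23's `not_fix_and_not_quot_of_mult_pStar_twist` needs no hypothesis on `V`.
[cite: SilvermanATAEC1994, Ch. V Lemma 5.2 (c), Thm. 5.3, Cor. 5.4] [cite: GreenbergVatsal2000, §2 pp. 14–15]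
[cite: SilvermanAEC2009, X.5 Cor. 5.4] -/
theorem not_fix_and_not_quot_of_nonsplitMult_pStar_twist (hp2 : p ≠ 2)
    (hmult : V.HasMultiplicativeReductionAtPrime p) (hns : ¬ V.HasSplitMultiplicativeReductionAtPrime p)
    (C : VariableChange ℚ) (hC : C • V.quadraticTwist ((-1 : ℚ) ^ (p / 2) * p) = W)
    {v : HeightOneSpectrum (𝓞 ℚ)} (hpv : ((p : ℕ) : 𝓞 ℚ) ∈ v.asIdeal)
    {𝔓 : Ideal (absIntegers (𝓞 ℚ) ℚ)} (h𝔓 : 𝔓 ∈ v.primesAbove)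
    {Φ : AddSubgroup (geomTorsion W (p : ℤ))} (hΦ : IsRationalLine W p Φ) :
    (¬ ∀ g ∈ 𝔓.decompositionSubgroup (absoluteGaloisGroup ℚ), ∀ P ∈ Φ, g • P = P) ∧
      (¬ ∀ g ∈ 𝔓.decompositionSubgroup (absoluteGaloisGroup ℚ),
        ∀ P : geomTorsion W (p : ℤ), g • P - P ∈ Φ) := by
  have hpP : p.Prime := hp.out
  haveI : NeZero p := ⟨hpP.ne_zero⟩
  set 𝔓₀ : Ideal (absIntegers (𝓞 ℚ) ℚ) := adicCompletionPrime ℚ v with h𝔓₀def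
  have h𝔓₀ : 𝔓₀ ∈ v.primesAbove := adicCompletionPrime_mem_primesAbove ℚ v
  have hD : 𝔓₀.decompositionSubgroup (absoluteGaloisGroup ℚ) = decomp (K := ℚ) v := by
    rw [h𝔓₀def, decompositionSubgroup_adicCompletionPrime_eq_range]; rfl
  have hID : 𝔓₀.inertia (absoluteGaloisGroup ℚ) ≤ 𝔓₀.decompositionSubgroup (absoluteGaloisGroup ℚ) :=
    Ideal.inertia_le_decompositionSubgroup _ _
  -- the Tate line `K ≤ V[p]` at `𝔓₀`
  obtain ⟨κc, hκc, -⟩ := exists_isCyclotomic_isTopGenerator_isCyclotomicVariable_holds p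
  obtain ⟨Ld, htriv, hgen, hC', -⟩ := GreenbergVatsalTateDatumCofree.exists_data_of_not_split V p κc
    TateCurve.Silverman1994_thmV53_corV54_tateUniformisation_holds hκc hp2 hmult hns
  obtain ⟨K, hK, hKI, σ₀, hσ₀I, Q₀, hQ₀K, hσ₀Q₀⟩ :=
    IsogenyLineType.exists_line_adicCompletionPrime_of_datum V p hpv (Ld v hpv) (htriv v hpv) (hgen v hpv) (hC' v hpv).2
  haveI : Finite K := Nat.finite_of_card_ne_zero (by rw [hK]; exact hpP.ne_zero)
  -- `K = ℤ l₀` with `l₀ = σ₀ Q₀ − Q₀ ≠ 0`, hence `K` is `D_{𝔓₀}`-stable (`I ⊴ D`)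
  set l₀ : geomTorsion V (p : ℤ) := σ₀ • Q₀ - Q₀ with hl₀
  have hl₀K : l₀ ∈ K := hKI σ₀ hσ₀I Q₀
  have hl₀0 : l₀ ≠ 0 := fun h ↦ hσ₀Q₀ (sub_eq_zero.mp h)
  have hKeq : AddSubgroup.zmultiples l₀ = K := by
    have hpl₀ : p • l₀ = 0 := by
      rw [← natCast_zsmul]
      exact Subtype.ext ((Submodule.mem_torsionBy_iff _ _).mp l₀.2)
    exact AddSubgroup.eq_of_le_of_card_ge (AddSubgroup.zmultiples_le_of_mem hl₀K)
      (by rw [hK, Nat.card_zmultiples, addOrderOf_eq_prime hpl₀ hl₀0])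
  have hKstab : ∀ g ∈ 𝔓₀.decompositionSubgroup (absoluteGaloisGroup ℚ), ∀ l ∈ K, g • l ∈ K := by
    intro g hg l hl
    have hgl₀ : g • l₀ ∈ K := by
      have hg𝔓 : g • 𝔓₀ = 𝔓₀ := Ideal.mem_decompositionSubgroup_iff.mp hg
      have hconj : g * σ₀ * g⁻¹ ∈ 𝔓₀.inertia (absoluteGaloisGroup ℚ) := by
        have h := (Ideal.conj_mem_inertia_smul_iff 𝔓₀ g σ₀).mpr hσ₀I
        rwa [hg𝔓] at h
      have h1 : g • l₀ = (g * σ₀ * g⁻¹) • (g • Q₀) - g • Q₀ := by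
        rw [hl₀, smul_sub, mul_smul, mul_smul, inv_smul_smul]
      rw [h1]
      exact hKI _ hconj _
    rw [← hKeq] at hl
    obtain ⟨k, rfl⟩ := AddSubgroup.mem_zmultiples_iff.mp hl
    rw [smul_comm]
    exact K.zsmul_mem hgl₀ k
  -- X2: some `g ∈ D_{𝔓₀}` acts non-trivially on `V[p]/K`
  obtain ⟨-, hquotK⟩ := TateLineDecomposition.not_fix_and_not_quot_of_not_split V p
    TateCurve.Silverman1994_thmV53_corV54_tateUniformisation_holds hp2 hmult hns hpv hK
  simp only [← hD, not_forall] at hquotK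
  obtain ⟨g, hgD, Q, hgQ⟩ := hquotK
  have hQK : Q ∉ K := fun hQ ↦ hgQ (K.sub_mem (hKstab g hgD Q hQ) hQ)
  have hQ0 : Q ≠ 0 := fun h ↦ hQK (h ▸ K.zero_mem)
  -- `V[p] = ℤQ ⊕ K`; `g Q = a Q + l₁`
  have hQcard : Nat.card (AddSubgroup.zmultiples Q) = p := by
    have hpQ : p • Q = 0 := by
      rw [← natCast_zsmul]; exact Subtype.ext ((Submodule.mem_torsionBy_iff _ _).mp Q.2)
    rw [Nat.card_zmultiples, addOrderOf_eq_prime hpQ hQ0]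
  have hne : AddSubgroup.zmultiples Q ≠ K := fun h ↦ hQK (h ▸ AddSubgroup.mem_zmultiples Q)
  obtain ⟨-, hsup⟩ := SemistableTwistLocalAnyLine.inf_eq_bot_and_sup_eq_top_of_ne hpP
    (Rank1Residual.natCard_geomTorsion V p) hQcard hK hne
  have hdec : ∀ x : geomTorsion V (p : ℤ), ∃ k : ℤ, ∃ l ∈ K, x = k • Q + l := fun x ↦ by
    have hx : x ∈ AddSubgroup.zmultiples Q ⊔ K := by rw [hsup]; exact AddSubgroup.mem_top x
    obtain ⟨y, hy, l, hl, rfl⟩ := AddSubgroup.mem_sup.mp hx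
    obtain ⟨k, rfl⟩ := AddSubgroup.mem_zmultiples_iff.mp hy
    exact ⟨k, l, hl, rfl⟩
  obtain ⟨a, l₁, hl₁K, hgQa⟩ := hdec (g • Q)
  have hga : ∀ x : geomTorsion V (p : ℤ), g • x - a • x ∈ K := by
    intro x
    obtain ⟨k, l, hlK, rfl⟩ := hdec x
    have h1 : g • (k • Q + l) - a • (k • Q + l) = k • (g • Q - a • Q) + (g • l - a • l) := by
      rw [smul_add g, smul_add a, smul_sub k, smul_comm g k Q, smul_comm a k Q]
      abel
    rw [h1]
    refine K.add_mem (K.zsmul_mem ?_ k) (K.sub_mem (hKstab g hgD l hlK) (K.zsmul_mem hlK a))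
    rw [hgQa, add_sub_cancel_left]
    exact hl₁K
  have hna : ¬ (p : ℤ) ∣ a - 1 := by
    rintro ⟨c, hc⟩
    apply hgQ
    have h1 : g • Q - Q = (g • Q - a • Q) + (a - 1) • Q := by rw [sub_smul, one_smul]; abel
    have hpQ : (p : ℤ) • Q = 0 := Subtype.ext ((Submodule.mem_torsionBy_iff _ _).mp Q.2)
    rw [h1, hc, mul_comm, mul_smul, hpQ, smul_zero, add_zero]
    exact hga Q
  -- correct `g` by inertia to `φ` with `χ̄_p(φ) = 1`
  obtain ⟨τ₀, hτ₀I, hτ₀⟩ :=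
    exists_mem_inertia_modPCyclotomicCharacterZMod_eq p hpv h𝔓₀ (modPCyclotomicCharacterZMod ℚ p g)⁻¹
  have hφD : g * τ₀ ∈ 𝔓₀.decompositionSubgroup (absoluteGaloisGroup ℚ) := Subgroup.mul_mem _ hgD (hID hτ₀I)
  have hφχ : modPCyclotomicCharacterZMod ℚ p (g * τ₀) = 1 := by rw [map_mul, hτ₀, mul_inv_cancel]
  have hφa : ∀ x : geomTorsion V (p : ℤ), (g * τ₀) • x - a • x ∈ K := by
    intro x
    have h1 : (g * τ₀) • x - a • x = g • (τ₀ • x - x) + (g • x - a • x) := by rw [mul_smul, smul_sub]; abel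
    rw [h1]
    exact K.add_mem (hKstab g hgD _ (hKI τ₀ hτ₀I x)) (hga x)
  have hφfix := smul_geomSqrt_pStar_eq_of_modPCyclotomicCharacterZMod_eq_one p hp2 hφχ
  rw [← pStar_cast p] at hC hφfix
  have h₀ := not_fix_and_not_quot_of_kernelLine hp2 C hC hpv (intValuation_pStar p hpv) h𝔓₀ hK hKI hφD hφfix hφχ hφa hna hΦ
  obtain ⟨σ, hσ⟩ := IsDedekindDomain.HeightOneSpectrum.exists_smul_eq_of_mem_primesAbove_holds h𝔓₀ h𝔓
  rw [← hσ]
  exact not_fix_and_not_quot_smul hΦ σ h₀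

variable (W) [W.IsElliptic]

/-- **Every subgroup of order `p`, given `Red W p`** (transfer by generation 24's
`not_fix_and_not_quot_of_red_of_forall_isRationalLine`). [cite: SilvermanATAEC1994, Ch. V Thm. 5.3, Cor. 5.4] [cite: SilvermanAEC2009, X.5 Cor. 5.4] -/
theorem not_fix_and_not_quot_of_nonsplitMult_pStar_twist_of_card_eq (hp2 : p ≠ 2)
    (hmult : V.HasMultiplicativeReductionAtPrime p) (hns : ¬ V.HasSplitMultiplicativeReductionAtPrime p)
    (C : VariableChange ℚ) (hC : C • V.quadraticTwist ((-1 : ℚ) ^ (p / 2) * p) = W) (hred : Red W p)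
    {v : HeightOneSpectrum (𝓞 ℚ)} (hpv : ((p : ℕ) : 𝓞 ℚ) ∈ v.asIdeal)
    {𝔓 : Ideal (absIntegers (𝓞 ℚ) ℚ)} (h𝔓 : 𝔓 ∈ v.primesAbove)
    {Φ : AddSubgroup (geomTorsion W (p : ℤ))} (hΦ : Nat.card Φ = p) :
    (¬ ∀ g ∈ 𝔓.decompositionSubgroup (absoluteGaloisGroup ℚ), ∀ P ∈ Φ, g • P = P) ∧
      (¬ ∀ g ∈ 𝔓.decompositionSubgroup (absoluteGaloisGroup ℚ),
        ∀ P : geomTorsion W (p : ℤ), g • P - P ∈ Φ) :=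
  SemistableTwistLocalAnyLine.not_fix_and_not_quot_of_red_of_forall_isRationalLine hred _
    (fun _ hΦ₀ ↦ not_fix_and_not_quot_of_nonsplitMult_pStar_twist p hp2 hmult hns C hC hpv h𝔓 hΦ₀) hΦ

/-! ### §2 The (M) cell of B6 ∩ X3 under the NON-SPLIT-TWIST clause -/

/-- **The (M) cell (`ClassX3 W p ∧ SubM W p`) under the per-pair clause «every multiplicative `p*`-twist model of `W` is NON-SPLIT»,
every odd `p` (new at `p = 3`: 1 127 of the 4 383 pairs of the cell at `p = 3`, kit j319291), every `𝔓 ∣ p`, every subgroup of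
order `p` of `W[p]`** — the `hna` input of generations 23–24's `_of_nonAnomalous` theorems on the (M) cell.  The models come from
`AdditivePotMult.PotMult.exists_mult_pStar_twist_model`. [cite: SilvermanATAEC1994, Ch. V Thm. 5.3, Cor. 5.4] [cite: SilvermanAEC2009, X.5 Cor. 5.4]
[cite: CastellaGrossiLeeSkinner2022, §1.2 (hypothesis θ|_{G_v̄} ≠ 𝟙, ω)] -/
theorem not_fix_and_not_quot_of_classX3_of_subM_of_forall_twist [W.IsGloballyMinimal] (hp2 : p ≠ 2) (hX : ClassX3 W p)
    (hSM : SubM W p)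
    (hns : ∀ (V : WeierstrassCurve ℚ) [V.IsElliptic] [V.IsGloballyMinimal] (C : VariableChange ℚ),
      Mult V p → C • V.quadraticTwist ((-1 : ℚ) ^ (p / 2) * p) = W → ¬ V.HasSplitMultiplicativeReductionAtPrime p)
    {v : HeightOneSpectrum (𝓞 ℚ)} (hpv : ((p : ℕ) : 𝓞 ℚ) ∈ v.asIdeal)
    {𝔓 : Ideal (absIntegers (𝓞 ℚ) ℚ)} (h𝔓 : 𝔓 ∈ v.primesAbove)
    {Φ : AddSubgroup (geomTorsion W (p : ℤ))} (hΦ : Nat.card Φ = p) :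
    (¬ ∀ g ∈ 𝔓.decompositionSubgroup (absoluteGaloisGroup ℚ), ∀ P ∈ Φ, g • P = P) ∧
      (¬ ∀ g ∈ 𝔓.decompositionSubgroup (absoluteGaloisGroup ℚ),
        ∀ P : geomTorsion W (p : ℤ), g • P - P ∈ Φ) := by
  have hpm : AdditivePotMult.PotMult W p := ⟨hX.2, hSM⟩
  obtain ⟨V, _, _, C, hV, hC⟩ := hpm.exists_mult_pStar_twist_model hp2
  exact not_fix_and_not_quot_of_nonsplitMult_pStar_twist_of_card_eq W p hp2 hV (hns V C hV hC) C hC hX.1 hpv h𝔓 hΦ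

end Mult

end Summit.BirchSwinnertonDyer.BirchSwinnertonDyer.Theorems.SchneiderFreeAdditiveX3.SemistableTwistLocalThree

end
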